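import Mathlib
import Summits.KontsevichZagierPeriods.Zeta5Search.Families.BasicGrowthBoundary
import HarnessLib

/-!
# ζ(5) search — Families: the growth constant is a MAXIMUM — `∃ t* ∈ S, f_σ(t*) = M_σ` for convergent `σ`

HONEST FRAMING: systematic search; no irrationality claim unless certified.  STRUCTURAL facts about the size of
Brown's basic cellular integrals [Brown2016, §1.5 (1.3)–(1.4)] (seat P2, Families layer); nothing about the
arithmetic of any zeta value.

`Families/BasicGrowth.lean` defined the growth constant `M_σ = fSup σ = sup_S f_σ` of a configuration (the decay rate
`I_σ(N)^{1/N} → M_σ`) as a supremum over the OPEN simplex.  With the boundary decay of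
`Families/BasicGrowthBoundary.lean` (`f_σ ≤ (ℓ+1)·gap_w`, so `{f_σ ≥ c}` lies in the `c/(ℓ+1)`-thick part of the
simplex) the supremum is ATTAINED:
* `thickSimplex ℓ δ = {t : every gap ≥ δ}` is compact (closed, inside the unit cube) and, for `δ > 0`, contained in
  the open simplex (`isCompact_thickSimplex`, `thickSimplex_subset_openSimplex`);
* **`exists_isMaxOn_fSigma`** / **`exists_fSigma_eq_fSup`** — for a bijective CONVERGENT seating there is a point
  `t* ∈ S` with `f_σ(t*) = M_σ`, i.e. `M_σ = max_S f_σ` (continuity of `f_σ` on the compact thick part containing a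
  superlevel set, and `f_σ <` that level outside it);
* `fSup_mem_image` — `M_σ ∈ f_σ(S)`.
The maximiser is the object of the critical-point analysis (Sinkhorn scaling equations, capacity duality) in the
sequel.  Standard axioms only.
-/

noncomputable section

open MeasureTheory Set Finset Filter Topology

namespace Summit.KontsevichZagierPeriods.Zeta5Search.Families.Cellular

variable {ℓ : ℕ} (σ : Fin (ℓ + 3) → Fin (ℓ + 3))

/-! ### The thick part of the simplex -/

/-- The `δ`-thick part of the simplex: all `ℓ + 1` gaps are at least `δ`. -/
def thickSimplex (ℓ : ℕ) (δ : ℝ) : Set (Fin ℓ → ℝ) := {t | ∀ w : Fin (ℓ + 1), δ ≤ gapN t w}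

/-- Membership in the thick part. -/
theorem mem_thickSimplex {δ : ℝ} {t : Fin ℓ → ℝ} : t ∈ thickSimplex ℓ δ ↔ ∀ w : Fin (ℓ + 1), δ ≤ gapN t w :=
  Iff.rfl

/-- For `δ > 0` the thick part lies in the open simplex. -/
theorem thickSimplex_subset_openSimplex {δ : ℝ} (hδ : 0 < δ) : thickSimplex ℓ δ ⊆ openSimplex ℓ :=
  fun t ht => (mem_openSimplex_iff_gapN t).2 fun w => hδ.trans_le (ht w)

/-- Each gap is a continuous function of `t`. -/
theorem continuous_gapN (w : ℕ) : Continuous fun t : Fin ℓ → ℝ => gapN t w :=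
  (continuous_pt _).sub (continuous_pt _)

/-- The thick part is closed. -/
theorem isClosed_thickSimplex (δ : ℝ) : IsClosed (thickSimplex ℓ δ) := by
  have : thickSimplex ℓ δ = ⋂ w : Fin (ℓ + 1), (fun t : Fin ℓ → ℝ => gapN t w) ⁻¹' Ici δ := by
    ext t; simp [thickSimplex]
  rw [this]
  exact isClosed_iInter fun w => isClosed_Ici.preimage (continuous_gapN w)

/-- The coordinates of a point of the open simplex lie in `(0, 1)`. -/
theorem apply_mem_Ioo_of_mem_openSimplex {t : Fin ℓ → ℝ} (ht : t ∈ openSimplex ℓ) (j : Fin ℓ) :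
    t j ∈ Ioo (0 : ℝ) 1 := by
  have hj : pt t (j.val + 1) = t j := by
    rw [pt_of_pos t (Nat.succ_pos _) (by have := j.isLt; omega)]
    congr 1
  have h0 : pt t 0 < pt t (j.val + 1) := pt_lt_pt ht (Nat.succ_pos _) (by have := j.isLt; omega)
  have h1 : pt t (j.val + 1) < pt t (ℓ + 1) := pt_lt_pt ht (by have := j.isLt; omega) le_rfl
  rw [pt_zero] at h0
  rw [pt_of_gt t le_rfl] at h1
  rw [hj] at h0 h1
  exact ⟨h0, h1⟩

/-- The open simplex lies in the closed unit cube. -/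
theorem openSimplex_subset_pi_Icc : openSimplex ℓ ⊆ Set.pi Set.univ fun _ : Fin ℓ => Icc (0 : ℝ) 1 :=
  fun _ ht j _ => Ioo_subset_Icc_self (apply_mem_Ioo_of_mem_openSimplex ht j)

/-- **The thick part of the simplex is compact** (`δ > 0`). -/
theorem isCompact_thickSimplex {δ : ℝ} (hδ : 0 < δ) : IsCompact (thickSimplex ℓ δ) :=
  (isCompact_univ_pi fun _ : Fin ℓ => isCompact_Icc).of_isClosed_subset (isClosed_thickSimplex δ)
    ((thickSimplex_subset_openSimplex hδ).trans openSimplex_subset_pi_Icc)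

/-- For a convergent seating, the superlevel set `{f_σ ≥ c}` lies in the `c/(ℓ+1)`-thick part. -/
theorem superlevel_subset_thickSimplex (hσ : Function.Bijective σ) (hc : Convergent σ) (c : ℝ) :
    openSimplex ℓ ∩ fSigma σ ⁻¹' Ici c ⊆ thickSimplex ℓ (c / ((ℓ : ℝ) + 1)) :=
  fun _ ht w => gapN_ge_of_le_fSigma σ hσ hc ht.1 ht.2 w

/-! ### The supremum is attained -/

/-- **The growth constant is a maximum.**  For a bijective CONVERGENT seating there is a point of the open simplex
at which Brown's function `f_σ` attains its supremum over the simplex: `IsMaxOn f_σ S t*`. -/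
theorem exists_isMaxOn_fSigma (hσ : Function.Bijective σ) (hc : Convergent σ) :
    ∃ t ∈ openSimplex ℓ, IsMaxOn (fSigma σ) (openSimplex ℓ) t := by
  set c : ℝ := fSup σ / 2 with hcdef
  have hcM : c < fSup σ := by rw [hcdef]; exact half_lt_self (fSup_pos σ hσ)
  obtain ⟨t1, ht1, hct1⟩ := exists_lt_fSigma σ hcM
  have hc0 : 0 < c := by rw [hcdef]; exact half_pos (fSup_pos σ hσ)
  set δ : ℝ := c / ((ℓ : ℝ) + 1) with hδdef
  have hδ : 0 < δ := by rw [hδdef]; positivity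
  have hK : IsCompact (thickSimplex ℓ δ) := isCompact_thickSimplex hδ
  have ht1K : t1 ∈ thickSimplex ℓ δ := fun w => gapN_ge_of_le_fSigma σ hσ hc ht1 hct1.le w
  obtain ⟨t0, ht0K, hmax⟩ := hK.exists_isMaxOn ⟨t1, ht1K⟩
    ((continuousOn_fSigma σ hσ.1).mono (thickSimplex_subset_openSimplex hδ))
  refine ⟨t0, thickSimplex_subset_openSimplex hδ ht0K, fun t ht => ?_⟩
  by_cases htK : t ∈ thickSimplex ℓ δ
  · exact hmax htK
  · -- outside the thick part some gap is `< δ`, so `f_σ(t) < c < f_σ(t1) ≤ f_σ(t0)`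
    obtain ⟨w, hw⟩ : ∃ w : Fin (ℓ + 1), gapN t w < δ := by
      by_contra h
      push Not at h
      exact htK h
    have h1 : fSigma σ t < c := fSigma_lt_of_gapN_lt σ hσ hc ht hw
    have h2 : c ≤ fSigma σ t0 := hct1.le.trans (hmax ht1K)
    exact (h1.trans_le h2).le

/-- **`M_σ = max_S f_σ`**: for a bijective convergent seating some point of the open simplex realises the growth
constant, `f_σ(t*) = M_σ`. -/
theorem exists_fSigma_eq_fSup (hσ : Function.Bijective σ) (hc : Convergent σ) :
    ∃ t ∈ openSimplex ℓ, fSigma σ t = fSup σ := by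
  obtain ⟨t0, ht0, hmax⟩ := exists_isMaxOn_fSigma σ hσ hc
  exact ⟨t0, ht0, le_antisymm (fSigma_le_fSup σ hσ ht0) (fSup_le_of_forall_le σ fun t ht => hmax ht)⟩

/-- The growth constant is a VALUE of `f_σ` on the open simplex. -/
theorem fSup_mem_image (hσ : Function.Bijective σ) (hc : Convergent σ) : fSup σ ∈ fSigma σ '' openSimplex ℓ := by
  obtain ⟨t0, ht0, h⟩ := exists_fSigma_eq_fSup σ hσ hc
  exact ⟨t0, ht0, h⟩

/-- A maximiser realises the growth constant, and conversely (any bijective seating). -/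
theorem isMaxOn_iff_fSigma_eq_fSup (hσ : Function.Bijective σ) {t : Fin ℓ → ℝ} (ht : t ∈ openSimplex ℓ) :
    IsMaxOn (fSigma σ) (openSimplex ℓ) t ↔ fSigma σ t = fSup σ := by
  constructor
  · intro hmax
    exact le_antisymm (fSigma_le_fSup σ hσ ht) (fSup_le_of_forall_le σ fun s hs => hmax hs)
  · intro h s hs
    change fSigma σ s ≤ fSigma σ t
    rw [h]
    exact fSigma_le_fSup σ hσ hs

/-- Every maximiser lies in the `M_σ/(ℓ+1)`-thick part of the simplex: all its gaps are `≥ M_σ/(ℓ+1)`. -/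
theorem gapN_ge_of_fSigma_eq_fSup (hσ : Function.Bijective σ) (hc : Convergent σ) {t : Fin ℓ → ℝ}
    (ht : t ∈ openSimplex ℓ) (h : fSigma σ t = fSup σ) (w : Fin (ℓ + 1)) :
    fSup σ / ((ℓ : ℝ) + 1) ≤ gapN t w :=
  gapN_ge_of_le_fSigma σ hσ hc ht h.ge w

end Summit.KontsevichZagierPeriods.Zeta5Search.Families.Cellular
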